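import Mathlib
import Literature.NumberTheory.LFunctions.Zhang2022.Section7SjPolylog
import Literature.NumberTheory.Sieve.ShiuUniform
import Literature.NumberTheory.Sieve.DivisorBound
import HarnessLib

/-!
# Zhang (2022) §11 p. 64: the `ξ₀ⱼ`-majorant `gC` in short intervals (Shiu packaging)

Topic `Literature/NumberTheory/LFunctions/Zhang2022` (Landau–Siegel audit tree; verdict-neutral).
Y. Zhang, *Discrete mean estimates and the Landau–Siegel zero*, arXiv:2211.02515v1 (2022)
[Zhang2022LandauSiegel], §11 p. 64 (tex L3299): the window mean square
"`ΣΣ𝔠*|Σ_{n∈𝔍₁}χψ(n)n^{−ρ}(f̃ − g̃₁)(n)|²ω = o(𝔞𝔓)` … by (11.3), (8.25) and (8.26)" (DAG nodes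
`Z22:§11.u019`, `§11.u021`; typed leaves `Typed.TypedSection11B.Step11u019`, `Step11u019J2`; GAP
row G-L3t10-1: the displays (8.25)/(8.26) do not exist in v1) — **an unrefereed manuscript under
adjudication; nothing here asserts or denies its Theorems 1–2.**

The lane's route to these leaves (ZHANG-L WP11, zl-w11-p4: `‖S_j(𝐚₁,𝐚₂)‖ ≤ B₁B₂·C·𝓛⁸` for
sequences supported on the three windows `(x_kη₋, x_kη₊)`) needs the multiplicative majorant
`gC = Λc·(w ∗ Kmaj) ≥ |ξ₀ⱼ(·;d,r)|` of `Section7SjPolylog` (`XiZeroMajorant.gC`, `norm_xiZero_le_gC`)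
averaged over SHORT multiplicative windows `(X, θX]`, `θ − 1 ≍ 𝓛⁻¹⁰`. This file is that helper
(DISCHARGE-CLAIMS «helper of zl-w11-p4: H1»): Shiu's Brun–Titchmarsh theorem for multiplicative
functions, in the tree's form UNIFORM IN THE FUNCTION (`Literature.NumberTheory.Sieve.shiu_uniform`),
applied to the family `gC c′ D` — whose prime-power values are bounded uniformly in `c′, D`
(`gC_prime_pow_le`: `gC(p^ν) ≤ 7(2+S₃)(ν+1)⁴`) — with the Euler exponent evaluated from a
prime bound `gC(p) ≤ a + K log p + M/p` (`p ≤ X`) taken as a hypothesis (the sharp instance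
`a = 3`, `K = 13·Bsum`, the shift-dependent one, is the WP11 engine's own lemma; `Section7SjPolylog`
has the crude `a = 5`):

* `gC_prime_pow_le_pow` — `gC(p^l) ≤ A₁^l`, `A₁ = 112(2+S₃)`, `l ≥ 1`;
* `gC_le_sigma_zero_pow`, `exists_rpow_majorant_gC` — `gC(n) ≤ τ(n)^{K_τ}`, hence
  `gC(n) ≤ A₂(δ)n^δ` with ONE `A₂` for all `c′, D`;
* `sum_primes_gC_div_le` — `Σ_{p≤X} gC(p)/p ≤ a(log log X + 4) + K(log X + log 4) + M`;
* `gC_shortInterval_le` — **absolute `C, x₀`** such that for all `c′, D, a, K, M` as above,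
  `X ≥ x₀`, `X^{1/4} ≤ y ≤ X`:
  `Σ_{X<n≤X+y} gC(n) ≤ C·e^{4a + K log(4X) + M}·(log X)^a·y/log X`;
* `gC_window_div_le` — the logarithmic window: for `1 < θ ≤ 2` with `(θ−1)X ≥ X^{1/4}`,
  `Σ_{X<n≤θX} gC(n)/n ≤ C·e^{4a + K log(4X) + M}·(log X)^a/log X·(θ − 1)`
  (with `a = 3`, `X ≤ P = e^{𝓛⁹}`, `K log(4X) = O(1)`, `θ − 1 ≍ 𝓛⁻¹⁰` this is the `O(𝓛⁸)` of the
  WP11 budget).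

0 definitions; standard axioms. Inputs: `Section7SjPolylog` (`gC`, `isMultiplicative_gC`,
`gC_nonneg`, `gC_prime_pow_le`), `Sieve.shiu_uniform`, `Sieve.exists_sigma_zero_le_mul_rpow`,
`MertensBound.sum_inv_prime_le`, `MertensBound.sum_log_div_prime_le`.

## References

* Y. Zhang, arXiv:2211.02515v1 (2022), §11 p. 64; §7 p. 33 (`ξ₀ⱼ`).
  [cite: Zhang2022LandauSiegel, §11 p.64]
* P. Shiu, J. reine angew. Math. 313 (1980), 161–170, Theorem 1. [cite: Shiu1980, Theorem 1]
-/

noncomputable section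

open Finset Real ArithmeticFunction
open scoped ArithmeticFunction.sigma

namespace Literature.NumberTheory.LFunctions.Zhang2022.XiZeroMajorant

open MeanSquareMajorant Literature.NumberTheory.Sieve

variable (c' : ℝ) (D : ℕ)

/-! ### Part 1. Uniform prime-power and divisor-type bounds for `gC` -/

omit c' D in
/-- `(l+1)^4 ≤ 16^l` for `l ≥ 1`. [folklore] -/
private theorem succ_pow_four_le (l : ℕ) (hl : 1 ≤ l) : ((l : ℝ) + 1) ^ 4 ≤ (16 : ℝ) ^ l := by
  have h1 : ((l + 1 : ℕ) : ℝ) ≤ (2 : ℝ) ^ l := by exact_mod_cast Nat.lt_two_pow_self (n := l)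
  have h2 : ((l : ℝ) + 1) ^ 4 ≤ ((2 : ℝ) ^ l) ^ 4 := by
    refine pow_le_pow_left₀ (by positivity) ?_ 4
    exact_mod_cast h1
  calc ((l : ℝ) + 1) ^ 4 ≤ ((2 : ℝ) ^ l) ^ 4 := h2
    _ = (16 : ℝ) ^ l := by rw [← pow_mul, mul_comm, pow_mul]; norm_num

/-- **`gC(p^l) ≤ A₁^l`** with `A₁ = 112(2 + S₃)` (`S₃ = LogEulerProduct.tailConst 3`), for every prime
`p`, `l ≥ 1`, uniformly in `c′, D` (from `gC(p^l) ≤ 7(2+S₃)(l+1)⁴` and `(l+1)⁴ ≤ 16^l`).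
[cite: Zhang2022LandauSiegel, §7 p.33] -/
theorem gC_prime_pow_le_pow {p l : ℕ} (hp : p.Prime) (hl : 1 ≤ l) :
    gC c' D (p ^ l) ≤ (112 * (2 + LogEulerProduct.tailConst 3)) ^ l := by
  have hT := LogEulerProduct.tailConst_nonneg 3
  have hc0 : (1 : ℝ) ≤ 7 * (2 + LogEulerProduct.tailConst 3) := by linarith
  have h1 := gC_prime_pow_le c' D hp l
  have h2 := succ_pow_four_le l hl
  have h3 : 7 * (2 + LogEulerProduct.tailConst 3) ≤ (7 * (2 + LogEulerProduct.tailConst 3)) ^ l :=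
    le_self_pow₀ hc0 (by omega)
  calc gC c' D (p ^ l) ≤ 7 * (2 + LogEulerProduct.tailConst 3) * ((l : ℝ) + 1) ^ 4 := h1
    _ ≤ (7 * (2 + LogEulerProduct.tailConst 3)) ^ l * (16 : ℝ) ^ l :=
        mul_le_mul h3 h2 (by positivity) (by positivity)
    _ = (112 * (2 + LogEulerProduct.tailConst 3)) ^ l := by rw [← mul_pow]; ring

/-- **`gC(p^ν) ≤ τ(p^ν)^{K_τ}`**, `K_τ = ⌈7(2+S₃)⌉ + 4` (`τ(p^ν) = ν + 1 ≥ 2` absorbs the constant: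
`7(2+S₃) ≤ 2^{⌈7(2+S₃)⌉} ≤ (ν+1)^{⌈7(2+S₃)⌉}`). [cite: Zhang2022LandauSiegel, §7 p.33] -/
theorem gC_prime_pow_le_sigma_zero_pow {p : ℕ} (hp : p.Prime) (ν : ℕ) :
    gC c' D (p ^ ν) ≤
      (((σ 0 (p ^ ν) : ℕ) : ℝ)) ^ (⌈7 * (2 + LogEulerProduct.tailConst 3)⌉₊ + 4) := by
  have hT := LogEulerProduct.tailConst_nonneg 3
  set c0 : ℝ := 7 * (2 + LogEulerProduct.tailConst 3) with hc0
  have hc00 : 0 ≤ c0 := by rw [hc0]; positivity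
  rw [ArithmeticFunction.sigma_zero_apply_prime_pow hp]
  rcases Nat.eq_zero_or_pos ν with rfl | hν
  · rw [pow_zero, (isMultiplicative_gC c' D).map_one]; norm_num
  have hν2 : (2 : ℝ) ≤ ((ν + 1 : ℕ) : ℝ) := by exact_mod_cast (by omega : 2 ≤ ν + 1)
  -- `c0 ≤ 2^⌈c0⌉ ≤ (ν+1)^⌈c0⌉`
  have h1 : c0 ≤ ((ν + 1 : ℕ) : ℝ) ^ ⌈c0⌉₊ := by
    have ha : c0 ≤ (⌈c0⌉₊ : ℝ) := Nat.le_ceil _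
    have hb : ((⌈c0⌉₊ : ℕ) : ℝ) ≤ (2 : ℝ) ^ ⌈c0⌉₊ := by
      exact_mod_cast (Nat.lt_two_pow_self (n := ⌈c0⌉₊)).le
    have hc : (2 : ℝ) ^ ⌈c0⌉₊ ≤ ((ν + 1 : ℕ) : ℝ) ^ ⌈c0⌉₊ := pow_le_pow_left₀ (by norm_num) hν2 _
    linarith
  have h2 := gC_prime_pow_le c' D hp ν
  have e : ((ν : ℝ) + 1) = ((ν + 1 : ℕ) : ℝ) := by push_cast; ring
  rw [e] at h2
  calc gC c' D (p ^ ν) ≤ c0 * ((ν + 1 : ℕ) : ℝ) ^ 4 := h2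
    _ ≤ ((ν + 1 : ℕ) : ℝ) ^ ⌈c0⌉₊ * ((ν + 1 : ℕ) : ℝ) ^ 4 :=
        mul_le_mul_of_nonneg_right h1 (by positivity)
    _ = ((ν + 1 : ℕ) : ℝ) ^ (⌈c0⌉₊ + 4) := by rw [← pow_add]

/-- **`gC(n) ≤ τ(n)^{K_τ}`** for every `n ≠ 0` (both sides multiplicative; compare on prime powers).
[cite: Zhang2022LandauSiegel, §7 p.33] -/
theorem gC_le_sigma_zero_pow {n : ℕ} (hn : n ≠ 0) :
    gC c' D n ≤ (((σ 0 n : ℕ) : ℝ)) ^ (⌈7 * (2 + LogEulerProduct.tailConst 3)⌉₊ + 4) := by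
  set K : ℕ := ⌈7 * (2 + LogEulerProduct.tailConst 3)⌉₊ + 4 with hK
  induction n using Nat.recOnPosPrimePosCoprime with
  | prime_pow p ν hp _ => exact gC_prime_pow_le_sigma_zero_pow c' D hp ν
  | zero => exact absurd rfl hn
  | one => rw [(isMultiplicative_gC c' D).map_one, ArithmeticFunction.isMultiplicative_sigma.map_one]; simp
  | coprime a b ha hb hab iha ihb =>
      rw [(isMultiplicative_gC c' D).map_mul_of_coprime hab,
        ArithmeticFunction.isMultiplicative_sigma.map_mul_of_coprime hab, Nat.cast_mul, mul_pow]
      exact mul_le_mul (iha (by omega)) (ihb (by omega)) (gC_nonneg c' D b) (by positivity)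

omit c' D in
/-- **The divisor-bound majorant, uniform in `c′, D`**: there is `A₂ : ℝ → ℝ` with
`gC c′ D (n) ≤ A₂(δ) n^δ` for all `c′, D`, `δ > 0`, `n ≥ 1` (`τ(n)^{K_τ} ≤ (C_{δ/K_τ} n^{δ/K_τ})^{K_τ}`).
[cite: Zhang2022LandauSiegel, §7 p.33] -/
theorem exists_rpow_majorant_gC : ∃ A₂ : ℝ → ℝ, ∀ (c' : ℝ) (D : ℕ) (δ : ℝ), 0 < δ →
    ∀ n : ℕ, 1 ≤ n → gC c' D n ≤ A₂ δ * (n : ℝ) ^ δ := by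
  classical
  set K : ℕ := ⌈7 * (2 + LogEulerProduct.tailConst 3)⌉₊ + 4 with hK
  have hch : ∀ δ : ℝ, 0 < δ → ∃ C : ℝ, 1 ≤ C ∧
      ∀ n : ℕ, ((σ 0 n : ℕ) : ℝ) ≤ C * (n : ℝ) ^ (δ / K) :=
    fun δ hδ => exists_sigma_zero_le_mul_rpow (by positivity)
  refine ⟨fun δ => if h : 0 < δ then (Classical.choose (hch δ h)) ^ K else 0, ?_⟩
  intro c' D δ hδ n hn
  dsimp only
  rw [dif_pos hδ]
  obtain ⟨hC1, hC⟩ := Classical.choose_spec (hch δ hδ)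
  set C := Classical.choose (hch δ hδ) with hCdef
  have hn0 : (0 : ℝ) < n := by exact_mod_cast hn
  have hKpos : (0 : ℝ) < K := by rw [hK]; positivity
  calc gC c' D n ≤ ((σ 0 n : ℕ) : ℝ) ^ K := gC_le_sigma_zero_pow c' D (by omega)
    _ ≤ (C * (n : ℝ) ^ (δ / K)) ^ K := pow_le_pow_left₀ (by positivity) (hC n) K
    _ = C ^ K * ((n : ℝ) ^ (δ / K)) ^ K := mul_pow _ _ _
    _ = C ^ K * (n : ℝ) ^ δ := by
        rw [← Real.rpow_natCast ((n : ℝ) ^ (δ / K)), ← Real.rpow_mul hn0.le]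
        congr 2
        field_simp

/-! ### Part 2. The Euler exponent under a prime bound `gC(p) ≤ a + K log p + M/p` -/

/-- **`Σ_{p≤X} gC(p)/p ≤ a(log log X + 4) + K(log X + log 4) + M`** for real `X ≥ 2`, whenever
`gC(p) ≤ a + K log p + M/p` at the primes `p ≤ X` (`K, M ≥ 0`; Mertens: tree
`MertensBound.sum_inv_prime_le`, `sum_log_div_prime_le`, `Σ 1/(p(p−1)) ≤ 1`). The sum is Shiu's
Euler exponent at `q = 1`. [cite: Zhang2022LandauSiegel, §7 p.33] -/
theorem sum_primes_gC_div_le {X : ℝ} (hX : 2 ≤ X) {a : ℕ} {K M : ℝ} (hK : 0 ≤ K) (hM : 0 ≤ M)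
    (hgp : ∀ p : ℕ, p.Prime → (p : ℝ) ≤ X → gC c' D p ≤ a + K * Real.log p + M / p) :
    ∑ p ∈ (Icc 1 ⌊X⌋₊).filter (fun p : ℕ => p.Prime ∧ ¬p ∣ 1), gC c' D p / p ≤
      a * (Real.log (Real.log X) + 4) + K * (Real.log X + Real.log 4) + M := by
  set N : ℕ := ⌊X⌋₊ with hN
  have hX0 : (0 : ℝ) ≤ X := by linarith
  have hN2 : 2 ≤ N := by rw [hN]; exact Nat.le_floor (by exact_mod_cast hX)
  have hNX : (N : ℝ) ≤ X := Nat.floor_le hX0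
  have hN0 : (0 : ℝ) < N := by exact_mod_cast (by omega : 0 < N)
  have hsub : (Icc 1 ⌊X⌋₊).filter (fun p : ℕ => p.Prime ∧ ¬p ∣ 1) ⊆ Nat.primesLE N := by
    intro p hp
    simp only [mem_filter, mem_Icc] at hp
    rw [Nat.mem_primesLE]
    exact ⟨hp.1.2, hp.2.1⟩
  have h1 : ∀ p ∈ Nat.primesLE N,
      gC c' D p / p ≤ a * (1 / p) + K * (Real.log p / p) + M * (1 / ((p : ℝ) * (p - 1))) := by
    intro p hp
    have hp' := (Nat.mem_primesLE.1 hp).2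
    have hpN := (Nat.mem_primesLE.1 hp).1
    have hp0 : (0 : ℝ) < p := by exact_mod_cast hp'.pos
    have hp2 : (2 : ℝ) ≤ p := by exact_mod_cast hp'.two_le
    have hpX : (p : ℝ) ≤ X := le_trans (by exact_mod_cast hpN) hNX
    have hb := hgp p hp' hpX
    have hM2 : M / p / p ≤ M * (1 / ((p : ℝ) * (p - 1))) := by
      rw [div_div, mul_one_div]
      exact div_le_div_of_nonneg_left hM (by nlinarith) (by nlinarith)
    calc gC c' D p / p ≤ (a + K * Real.log p + M / p) / p :=
          div_le_div_of_nonneg_right hb hp0.le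
      _ = a * (1 / p) + K * (Real.log p / p) + M / p / p := by ring
      _ ≤ _ := by linarith
  calc ∑ p ∈ (Icc 1 ⌊X⌋₊).filter (fun p : ℕ => p.Prime ∧ ¬p ∣ 1), gC c' D p / p
      ≤ ∑ p ∈ Nat.primesLE N, gC c' D p / p :=
        sum_le_sum_of_subset_of_nonneg hsub fun p _ _ => div_nonneg (gC_nonneg c' D p) (by positivity)
    _ ≤ ∑ p ∈ Nat.primesLE N,
          (a * (1 / p) + K * (Real.log p / p) + M * (1 / ((p : ℝ) * (p - 1)))) := sum_le_sum h1
    _ = a * ∑ p ∈ Nat.primesLE N, (1 : ℝ) / p + K * ∑ p ∈ Nat.primesLE N, Real.log p / p +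
          M * ∑ p ∈ Nat.primesLE N, (1 : ℝ) / (p * (p - 1)) := by
        rw [sum_add_distrib, sum_add_distrib, mul_sum, mul_sum, mul_sum]
    _ ≤ a * (Real.log (Real.log N) + 4) + K * (Real.log N + Real.log 4) + M * 1 := by
        gcongr
        · exact MertensBound.sum_inv_prime_le N hN2
        · exact MertensBound.sum_log_div_prime_le N
        · exact MertensBound.sum_inv_prime_mul_pred_le_one N
    _ ≤ a * (Real.log (Real.log X) + 4) + K * (Real.log X + Real.log 4) + M := by
        have hlogN : Real.log N ≤ Real.log X := Real.log_le_log hN0 hNX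
        have hlogN2 : 0 < Real.log N := Real.log_pos (by exact_mod_cast (by omega : 1 < N))
        have hll : Real.log (Real.log N) ≤ Real.log (Real.log X) := Real.log_le_log hlogN2 hlogN
        have ha0 : (0 : ℝ) ≤ a := Nat.cast_nonneg a
        nlinarith [mul_le_mul_of_nonneg_left hll ha0, mul_le_mul_of_nonneg_left hlogN hK]

/-! ### Part 3. Shiu's theorem for `gC`: short intervals, uniformly in `c′, D` -/

/-- **`gC` in short intervals (Shiu packaging), absolute constants**: there are `C ≥ 0` and
`x₀ ≥ 2` such that for ALL `c′, D`, all `a : ℕ`, `K, M ≥ 0` with `gC(p) ≤ a + K log p + M/p` at the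
primes `p ≤ X`, and all `X ≥ x₀`, `X^{1/4} ≤ y ≤ X`:
`Σ_{X<n≤X+y} gC c′ D (n) ≤ C·e^{4a + K log(4X) + M}·(log X)^a·(y/log X)`
(Shiu 1980 Thm 1 with `ε = θ = 1/4`, `q = 1`, via `Sieve.shiu_uniform`; the exponent by
`sum_primes_gC_div_le`). [cite: Shiu1980, Theorem 1] -/
theorem gC_shortInterval_le : ∃ C x₀ : ℝ, 0 ≤ C ∧ 2 ≤ x₀ ∧
    ∀ (c' : ℝ) (D : ℕ) (a : ℕ) (K M : ℝ), 0 ≤ K → 0 ≤ M → ∀ X y : ℝ, x₀ ≤ X →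
      X ^ (1 / 4 : ℝ) ≤ y → y ≤ X →
      (∀ p : ℕ, p.Prime → (p : ℝ) ≤ X → gC c' D p ≤ a + K * Real.log p + M / p) →
      ∑ n ∈ (Icc 1 ⌊X + y⌋₊).filter (fun n : ℕ => X < n), gC c' D n ≤
        C * Real.exp (4 * a + K * Real.log (4 * X) + M) * Real.log X ^ a * (y / Real.log X) := by
  obtain ⟨A₂, hA₂⟩ := exists_rpow_majorant_gC
  have hT := LogEulerProduct.tailConst_nonneg 3
  obtain ⟨C, x₀, hC0, hS⟩ := shiu_uniform (A₁ := 112 * (2 + LogEulerProduct.tailConst 3))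
    (by positivity) A₂ (ε := 1 / 4) (θ := 1 / 4) (by norm_num) (by norm_num) (by norm_num) (by norm_num)
  refine ⟨C, max x₀ 2, hC0, le_max_right _ _, ?_⟩
  intro c' D a K M hK hM X y hX hy hyX hgp
  have hX2 : 2 ≤ X := le_trans (le_max_right _ _) hX
  have hX1 : 1 < X := by linarith
  have hX0 : 0 < X := by linarith
  have hlogX : 0 < Real.log X := Real.log_pos hX1
  set f : ℕ → ℝ := fun n => gC c' D n with hf
  have hf0 : ∀ n, 0 ≤ f n := fun n => gC_nonneg c' D n
  have hmul : ∀ m n : ℕ, m.Coprime n → f (m * n) = f m * f n :=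
    fun m n h => (isMultiplicative_gC c' D).map_mul_of_coprime h
  have hpl : ∀ p l : ℕ, p.Prime → 1 ≤ l → f (p ^ l) ≤ (112 * (2 + LogEulerProduct.tailConst 3)) ^ l :=
    fun p l hp hl => gC_prime_pow_le_pow c' D hp hl
  have hmaj : ∀ δ : ℝ, 0 < δ → ∀ n : ℕ, 1 ≤ n → f n ≤ A₂ δ * (n : ℝ) ^ δ :=
    fun δ hδ n hn => hA₂ c' D δ hδ n hn
  -- Shiu with `q = 1`, `a = 0`
  have hy0 : 0 < y := lt_of_lt_of_le (Real.rpow_pos_of_pos hX0 _) hy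
  have hq : ((1 : ℕ) : ℝ) < y ^ (1 - 1 / 4 : ℝ) := by
    rw [Nat.cast_one]
    have hy1 : 1 < y := by
      refine lt_of_lt_of_le ?_ hy
      exact Real.one_lt_rpow hX1 (by norm_num)
    exact Real.one_lt_rpow hy1 (by norm_num)
  have h := hS f hf0 hmul hpl hmaj X y (le_trans (le_max_left _ _) hX) hy hyX 1 le_rfl hq 0
    (Nat.coprime_one_right 0)
  have hset : (Icc 1 ⌊X + y⌋₊).filter (fun n : ℕ => X < n ∧ (n : ZMod 1) = ((0 : ℕ) : ZMod 1)) =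
      (Icc 1 ⌊X + y⌋₊).filter (fun n : ℕ => X < n) := by
    refine filter_congr fun n _ => ?_
    simp [Subsingleton.elim (n : ZMod 1) 0]
  rw [hset, Nat.totient_one, Nat.cast_one, one_mul] at h
  refine h.trans ?_
  -- the Euler factor
  have hE := sum_primes_gC_div_le c' D hX2 hK hM hgp
  have hexp : Real.exp (∑ p ∈ (Icc 1 ⌊X⌋₊).filter (fun p : ℕ => p.Prime ∧ ¬p ∣ 1), f p / p) ≤
      Real.exp (4 * a + K * Real.log (4 * X) + M) * Real.log X ^ a := by
    calc Real.exp (∑ p ∈ (Icc 1 ⌊X⌋₊).filter (fun p : ℕ => p.Prime ∧ ¬p ∣ 1), f p / p)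
        ≤ Real.exp (a * (Real.log (Real.log X) + 4) + K * (Real.log X + Real.log 4) + M) :=
          Real.exp_le_exp.mpr hE
      _ = Real.exp (4 * a + K * Real.log (4 * X) + M) * Real.log X ^ a := by
          have e1 : Real.log (4 * X) = Real.log X + Real.log 4 := by
            rw [Real.log_mul (by norm_num) hX0.ne', add_comm]
          have e2 : Real.log X ^ a = Real.exp (a * Real.log (Real.log X)) := by
            rw [← Real.log_pow, Real.exp_log (pow_pos hlogX a)]
          rw [e1, e2, ← Real.exp_add]
          congr 1; ring
  calc C * y / Real.log X *
        Real.exp (∑ p ∈ (Icc 1 ⌊X⌋₊).filter (fun p : ℕ => p.Prime ∧ ¬p ∣ 1), f p / p)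
      ≤ C * y / Real.log X * (Real.exp (4 * a + K * Real.log (4 * X) + M) * Real.log X ^ a) :=
        mul_le_mul_of_nonneg_left hexp (by positivity)
    _ = C * Real.exp (4 * a + K * Real.log (4 * X) + M) * Real.log X ^ a * (y / Real.log X) := by
        ring

/-- **The logarithmic window `Σ_{X<n≤θX} gC(n)/n`**: with the same absolute `C, x₀`, for all
`c′, D, a, K, M` as in `gC_shortInterval_le`, `X ≥ x₀`, `1 < θ ≤ 2` and `X^{1/4} ≤ (θ−1)X`:
`Σ_{X<n≤θX} gC c′ D (n)/n ≤ C·e^{4a + K log(4X) + M}·(log X)^a/log X·(θ − 1)`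
(`1/n < 1/X` on the window, `y = (θ−1)X`). [cite: Zhang2022LandauSiegel, §11 p.64] -/
theorem gC_window_div_le : ∃ C x₀ : ℝ, 0 ≤ C ∧ 2 ≤ x₀ ∧
    ∀ (c' : ℝ) (D : ℕ) (a : ℕ) (K M : ℝ), 0 ≤ K → 0 ≤ M → ∀ X θ : ℝ, x₀ ≤ X → 1 < θ → θ ≤ 2 →
      X ^ (1 / 4 : ℝ) ≤ (θ - 1) * X →
      (∀ p : ℕ, p.Prime → (p : ℝ) ≤ X → gC c' D p ≤ a + K * Real.log p + M / p) →
      ∑ n ∈ (Icc 1 ⌊θ * X⌋₊).filter (fun n : ℕ => X < n), gC c' D n / n ≤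
        C * Real.exp (4 * a + K * Real.log (4 * X) + M) * Real.log X ^ a / Real.log X * (θ - 1) := by
  obtain ⟨C, x₀, hC0, hx₀, hS⟩ := gC_shortInterval_le
  refine ⟨C, x₀, hC0, hx₀, ?_⟩
  intro c' D a K M hK hM X θ hX hθ hθ2 hy hgp
  have hX2 : 2 ≤ X := le_trans hx₀ hX
  have hX0 : 0 < X := by linarith
  set y : ℝ := (θ - 1) * X with hy_def
  have hyX : y ≤ X := by rw [hy_def]; nlinarith
  have hθX : θ * X = X + y := by rw [hy_def]; ring
  have h := hS c' D a K M hK hM X y hX hy hyX hgp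
  rw [hθX]
  -- `gC(n)/n ≤ gC(n)/X` on the window
  have hwin : ∀ n ∈ (Icc 1 ⌊X + y⌋₊).filter (fun n : ℕ => X < n),
      gC c' D n / n ≤ gC c' D n / X := by
    intro n hn
    have hXn : X < n := (mem_filter.1 hn).2
    exact div_le_div_of_nonneg_left (gC_nonneg c' D n) hX0 hXn.le
  calc ∑ n ∈ (Icc 1 ⌊X + y⌋₊).filter (fun n : ℕ => X < n), gC c' D n / n
      ≤ ∑ n ∈ (Icc 1 ⌊X + y⌋₊).filter (fun n : ℕ => X < n), gC c' D n / X := sum_le_sum hwin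
    _ = (∑ n ∈ (Icc 1 ⌊X + y⌋₊).filter (fun n : ℕ => X < n), gC c' D n) / X := by
        rw [sum_div]
    _ ≤ C * Real.exp (4 * a + K * Real.log (4 * X) + M) * Real.log X ^ a * (y / Real.log X) / X :=
        div_le_div_of_nonneg_right h hX0.le
    _ = C * Real.exp (4 * a + K * Real.log (4 * X) + M) * Real.log X ^ a / Real.log X * (θ - 1) := by
        rw [hy_def]; field_simp

end Literature.NumberTheory.LFunctions.Zhang2022.XiZeroMajorant
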